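import Summits.AtomisticToContinuum.Crystallization.Theorems.CoarseGrains.Negative.PredicateAPI
import Literature.MathematicalPhysics.StatisticalMechanics.LocalMatchingCompactness
import Summits.AtomisticToContinuum.Crystallization.Theorems.PhononStability.Negative.Mirror

/-!
# `ExcessDecayLiouville.GrainsGlue`, helper file 2: coarse matching and admissible data pass to local limits

Route `ExcessDecayLiouville` (sub-problem `Crystallization`), support item
`stmt-AtomisticToContinuum-9336` (`GrainsGlue`).  Vocabulary (`Lam`, `Near`, `Adm`, `Inner`, the
verbatim `let`-predicates of the route) from `CoarseGrains.Negative.PredicateAPI`.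

* `near_of_ball_subset`, `near_add_const`, `near_reindex` — the two-way matching predicate is
  monotone in the ball, translation covariant, and invariant under re-indexing the sites by a
  period `z₀ ∈ Λ`;
* `adm_of_tendsto` — the admissible cells form a closed set (limits of isometries along a
  subsequence are isometries: compactness of the unit ball of `ℝ³ →L ℝ³`);
* `inner_of_tendsto` — the hcp-like inner displacement condition is closed;
* `exists_forall_dist_site_le` — every point has a NEAREST site of an admissible datum (`Λ` is
  uniformly discrete and `A` is bounded below);
* `continuousAt_deriv_lennardJones`, `continuousAt_force_apply`, `continuousAt_sum_force` — the
  Lennard-Jones pair force `F(p, q) = (V′(|p−q|)/|p−q|)(p−q)` and its finite sums are continuous off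
  the diagonal; `near_of_ballMatch_sites` — a set `BallMatch`ed with an exact two-lattice is `Near` it;
* `near_of_limit` — **global coarse matching of local limits**: if point sets `Y_k` are two-way
  `1/40`-matched on the balls `‖·‖ ≤ k` with admissible data `(t_k, A_k) → (t, A)`, and `Y_k → Y`
  locally (`BallMatch` on every ball at every tolerance, eventually) with `Y` uniformly discrete,
  then `Y` is two-way `1/40`-matched with `(t, A)` on EVERY ball: matching at tolerance `1/40` is a
  closed condition because both the sites and `Y` are locally finite.
-/

noncomputable section

open scoped BigOperators Topology
open Filter Metric Literature.MathematicalPhysics.StatisticalMechanics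
open Summit.AtomisticToContinuum.Crystallization.Theorems.CoarseGrains.Negative.PredicateAPI

namespace Summit.AtomisticToContinuum.Crystallization.Theorems.ExcessDecayLiouvilleGrainsGlue

open PhononStabilityNegative (deriv_lennardJones)

/-! ### Elementary moves on `Near` -/

/-- `Near` is monotone in the ball: a ball inside the matched ball is matched. [folklore] -/
theorem near_of_ball_subset {X : Set E3} {c c' : E3} {r r' : ℝ} {t : Fin 2 → E3}
    {A : E3 →L[ℝ] E3} {ε : ℝ} (h : Near X c r t A ε) (hcr : dist c' c + r' ≤ r) :
    Near X c' r' t A ε := by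
  refine ⟨fun p hp hpc => h.1 p hp ?_, fun m z hz hzc => h.2 m z hz ?_⟩
  · linarith [dist_triangle p c' c]
  · linarith [dist_triangle (t m + A z) c' c]

/-- `Near` is translation covariant. [folklore] -/
theorem near_add_const {X : Set E3} {c : E3} {r : ℝ} {t : Fin 2 → E3} {A : E3 →L[ℝ] E3}
    {ε : ℝ} (h : Near X c r t A ε) (v : E3) :
    Near ((fun p => p + v) '' X) (c + v) r (fun m => t m + v) A ε := by
  refine ⟨?_, fun m z hz hzc => ?_⟩
  · rintro _ ⟨p, hp, rfl⟩ hpc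
    rw [dist_add_right] at hpc
    obtain ⟨m, z, hz, hd⟩ := h.1 p hp hpc
    refine ⟨m, z, hz, ?_⟩
    rwa [add_right_comm, dist_add_right]
  · rw [add_right_comm, dist_add_right] at hzc
    obtain ⟨p, hp, hd⟩ := h.2 m z hz hzc
    refine ⟨p + v, Set.mem_image_of_mem _ hp, ?_⟩
    rwa [add_right_comm, dist_add_right]

/-- Re-indexing the sites by a period: the data `t` and `m ↦ t m + A z₀` (`z₀ ∈ Λ`) have the same
sites, hence the same matchings. [folklore] -/
theorem near_reindex {X : Set E3} {c : E3} {r : ℝ} {t : Fin 2 → E3} {A : E3 →L[ℝ] E3}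
    {ε : ℝ} {z₀ : E3} (hz₀ : z₀ ∈ Lam) (h : Near X c r t A ε) :
    Near X c r (fun m => t m + A z₀) A ε := by
  refine ⟨fun p hp hpc => ?_, fun m z hz hzc => ?_⟩
  · obtain ⟨m, z, hz, hd⟩ := h.1 p hp hpc
    refine ⟨m, z - z₀, lam_sub_mem hz hz₀, ?_⟩
    rwa [map_sub, add_add_sub_cancel]
  · have he : t m + A z₀ + A z = t m + A (z₀ + z) := by rw [map_add, add_assoc]
    rw [he] at hzc ⊢
    exact h.2 m (z₀ + z) (lam_add_mem hz₀ hz) hzc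

/-- An exact two-lattice `Y = {t'_m + A' z}` that is a local limit of the `Y_k` is finely matched by
them: if `BallMatch ε ρ 0 (Y_k) Y` then `Near (Y_k) 0 ρ t' A' ε`. [folklore] -/
theorem near_of_ballMatch_sites {X Y : Set E3} {t' : Fin 2 → E3} {A' : E3 →L[ℝ] E3} {ε ρ : ℝ}
    (hY : Y = {p | ∃ m : Fin 2, ∃ z ∈ Lam, p = t' m + A' z}) (h : BallMatch ε ρ 0 X Y) :
    Near X 0 ρ t' A' ε := by
  refine ⟨fun p hp hp0 => ?_, fun m z hz hz0 => ?_⟩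
  · obtain ⟨y, hy, hpy⟩ := h.2 p hp hp0
    rw [hY] at hy
    obtain ⟨m, z, hz, rfl⟩ := hy
    exact ⟨m, z, hz, hpy⟩
  · have hmem : t' m + A' z ∈ Y := by
      rw [hY]
      exact ⟨m, z, hz, rfl⟩
    obtain ⟨p, hp, hd⟩ := h.1 _ hmem hz0
    exact ⟨p, hp, hd⟩


/-! ### Continuity of the pair force off the diagonal -/

/-- `V′_LJ` is continuous away from `0`. [folklore] -/
theorem continuousAt_deriv_lennardJones {r : ℝ} (hr : r ≠ 0) :
    ContinuousAt (deriv lennardJones) r := by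
  have hev : (fun y : ℝ => -(y⁻¹) ^ 13 + (y⁻¹) ^ 7) =ᶠ[𝓝 r] deriv lennardJones := by
    filter_upwards [eventually_ne_nhds hr] with y hy using (deriv_lennardJones hy).symm
  have h : ContinuousAt (fun y : ℝ => y⁻¹) r := continuousAt_inv₀ hr
  exact (((h.pow 13).neg).add (h.pow 7)).congr hev

/-- The pair force `(a, b) ↦ F(a, b q)` as a function of a point `a` and a family of points `b` is
continuous at every `(a₀, b₀)` with `a₀ ≠ b₀ q`. [folklore] -/
theorem continuousAt_force_apply {ι : Type*} [Fintype ι] (i : ι) {v₀ : E3 × (ι → E3)}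
    (h : v₀.1 ≠ v₀.2 i) :
    ContinuousAt (fun v : E3 × (ι → E3) =>
      (deriv lennardJones (dist v.1 (v.2 i)) / dist v.1 (v.2 i)) • (v.1 - v.2 i)) v₀ := by
  have hd : Continuous fun v : E3 × (ι → E3) => dist v.1 (v.2 i) :=
    continuous_fst.dist ((continuous_apply i).comp continuous_snd)
  have hd0 : dist v₀.1 (v₀.2 i) ≠ 0 := dist_ne_zero.2 h
  have h1 : ContinuousAt (fun v : E3 × (ι → E3) => deriv lennardJones (dist v.1 (v.2 i))) v₀ :=
    ContinuousAt.comp_of_eq (continuousAt_deriv_lennardJones hd0) hd.continuousAt rfl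
  have h2 : ContinuousAt (fun v : E3 × (ι → E3) =>
      deriv lennardJones (dist v.1 (v.2 i)) / dist v.1 (v.2 i)) v₀ :=
    h1.div hd.continuousAt hd0
  have h3 : Continuous fun v : E3 × (ι → E3) => v.1 - v.2 i :=
    continuous_fst.sub ((continuous_apply i).comp continuous_snd)
  exact h2.smul h3.continuousAt

/-- The finite force sum `(a, b) ↦ ∑ᵢ F(a, bᵢ)` is continuous at every `(a₀, b₀)` with `a₀ ≠ b₀ i`
for all `i`. [folklore] -/
theorem continuousAt_sum_force {ι : Type*} [Fintype ι] {v₀ : E3 × (ι → E3)}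
    (h : ∀ i, v₀.1 ≠ v₀.2 i) :
    ContinuousAt (fun v : E3 × (ι → E3) =>
      ∑ i, (deriv lennardJones (dist v.1 (v.2 i)) / dist v.1 (v.2 i)) • (v.1 - v.2 i)) v₀ := by
  have := tendsto_finsetSum (Finset.univ : Finset ι)
    (f := fun i (v : E3 × (ι → E3)) =>
      (deriv lennardJones (dist v.1 (v.2 i)) / dist v.1 (v.2 i)) • (v.1 - v.2 i)) (x := 𝓝 v₀)
    (a := fun i => (deriv lennardJones (dist v₀.1 (v₀.2 i)) / dist v₀.1 (v₀.2 i)) • (v₀.1 - v₀.2 i))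
    fun i _ => continuousAt_force_apply i (h i)
  exact this

/-! ### Closedness of the admissible data -/

/-- **Admissible cells form a closed set**: a limit of admissible cells is admissible (extract a
convergent subsequence of the witnessing isometries in the compact unit ball of `ℝ³ →L ℝ³`; the
limit is norm preserving, hence a linear isometry equivalence). [folklore] -/
theorem adm_of_tendsto {A : ℕ → E3 →L[ℝ] E3} {Ainf : E3 →L[ℝ] E3} (hA : ∀ k, Adm (A k))
    (hlim : Tendsto A atTop (𝓝 Ainf)) : Adm Ainf := by
  choose R hR using hA
  set Rc : ℕ → (E3 →L[ℝ] E3) := fun k => ((R k).toContinuousLinearEquiv : E3 →L[ℝ] E3) with hRc_def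
  have hRc_apply : ∀ k v, Rc k v = R k v := fun k v => by simp [hRc_def]
  have hRc : ∀ k, Rc k ∈ closedBall (0 : E3 →L[ℝ] E3) 1 := fun k => by
    rw [mem_closedBall, dist_zero_right]
    refine ContinuousLinearMap.opNorm_le_bound _ zero_le_one fun v => ?_
    rw [hRc_apply, LinearIsometryEquiv.norm_map, one_mul]
  obtain ⟨R', -, φ, hφ, hRlim⟩ := (isCompact_closedBall (0 : E3 →L[ℝ] E3) 1).tendsto_subseq hRc
  have hnorm : ∀ v, ‖R' v‖ = ‖v‖ := fun v => by
    have h1 : Tendsto (fun k => Rc (φ k) v) atTop (𝓝 (R' v)) :=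
      ((ContinuousLinearMap.apply ℝ E3 v).continuous.tendsto R').comp hRlim
    have h3 : Tendsto (fun k => ‖Rc (φ k) v‖) atTop (𝓝 ‖R' v‖) := h1.norm
    have h2 : (fun k => ‖Rc (φ k) v‖) = fun _ => ‖v‖ := by
      funext k
      rw [hRc_apply, LinearIsometryEquiv.norm_map]
    rw [h2] at h3
    exact tendsto_nhds_unique h3 tendsto_const_nhds
  let Rli : E3 →ₗᵢ[ℝ] E3 := ⟨(R' : E3 →ₗ[ℝ] E3), hnorm⟩
  let Rinf : E3 ≃ₗᵢ[ℝ] E3 := Rli.toLinearIsometryEquiv rfl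
  refine ⟨Rinf, ?_⟩
  have hcoe : (Rinf.toContinuousLinearEquiv : E3 →L[ℝ] E3) = R' := by
    ext v
    rfl
  rw [hcoe]
  have hlim' : Tendsto (fun k => A (φ k) - (97 / 100 : ℝ) • Rc (φ k)) atTop
      (𝓝 (Ainf - (97 / 100 : ℝ) • R')) :=
    (hlim.comp hφ.tendsto_atTop).sub (hRlim.const_smul _)
  exact le_of_tendsto hlim'.norm (Eventually.of_forall fun k => hR (φ k))

/-- The hcp-like inner displacement condition is closed. [folklore] -/
theorem inner_of_tendsto {A : ℕ → E3 →L[ℝ] E3} {Ainf : E3 →L[ℝ] E3} {t : ℕ → Fin 2 → E3}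
    {tinf : Fin 2 → E3} (hI : ∀ k, Inner (t k) (A k)) (hlimA : Tendsto A atTop (𝓝 Ainf))
    (hlimt : Tendsto t atTop (𝓝 tinf)) : Inner tinf Ainf := by
  set off : E3 := barlowOffset 1 + layerNormal (Real.sqrt (2 / 3)) with hoff
  have h1 : Tendsto (fun k => t k 1) atTop (𝓝 (tinf 1)) := (continuous_apply 1).continuousAt.tendsto.comp hlimt
  have h0 : Tendsto (fun k => t k 0) atTop (𝓝 (tinf 0)) := (continuous_apply 0).continuousAt.tendsto.comp hlimt
  have hA : Tendsto (fun k => A k off) atTop (𝓝 (Ainf off)) :=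
    ((ContinuousLinearMap.apply ℝ E3 off).continuous.tendsto Ainf).comp hlimA
  have h := ((h1.sub h0).sub hA).norm
  exact le_of_tendsto h (Eventually.of_forall fun k => hI k)

/-! ### Nearest sites -/

/-- Every point `p` has a nearest site among the sites `t m + A z` (`z ∈ Λ`) of an admissible
datum: far sites are farther than the site `t 0 + A 0`, and the near ones are finitely many.
[folklore] -/
theorem exists_forall_dist_site_le {A : E3 →L[ℝ] E3} (hA : Adm A) (t : Fin 2 → E3) (p : E3) :
    ∃ m : Fin 2, ∃ z ∈ Lam, ∀ m' : Fin 2, ∀ z' ∈ Lam,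
      dist p (t m + A z) ≤ dist p (t m' + A z') := by
  classical
  set D : ℝ := dist p (t 0 + A 0) with hD
  set Tn : ℝ := ‖t 0‖ + ‖t 1‖ with hTn
  set B : ℝ := 200 / 189 * (D + ‖p‖ + Tn) with hB
  have hB0 : 0 ≤ B := by positivity
  have htm : ∀ m : Fin 2, ‖t m‖ ≤ Tn := by
    intro m
    fin_cases m <;> simp [hTn]
  have hfin : (Lam ∩ closedBall (0 : E3) B).Finite :=
    finite_of_forall_le_dist_of_subset_closedBall one_pos
      (fun a ha b hb hab => one_le_dist_of_mem_lam ha.1 hb.1 hab) Set.inter_subset_right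
  set S : Finset (Fin 2 × E3) := Finset.univ ×ˢ hfin.toFinset with hS
  have h00 : ((0 : Fin 2), (0 : E3)) ∈ S := by
    simp only [hS, Finset.mem_product, Finset.mem_univ, true_and, Set.Finite.mem_toFinset]
    exact ⟨zero_mem_lam, mem_closedBall.2 (by simpa using hB0)⟩
  obtain ⟨⟨m, z⟩, hmz, hmin⟩ :=
    S.exists_min_image (fun mz : Fin 2 × E3 => dist p (t mz.1 + A mz.2)) ⟨_, h00⟩
  have hzS : z ∈ Lam ∧ ‖z‖ ≤ B := by
    simp only [hS, Finset.mem_product, Finset.mem_univ, true_and, Set.Finite.mem_toFinset,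
      Set.mem_inter_iff, mem_closedBall, dist_zero_right] at hmz
    exact hmz
  refine ⟨m, z, hzS.1, fun m' z' hz' => ?_⟩
  by_cases hzB : ‖z'‖ ≤ B
  · have hmem : (m', z') ∈ S := by
      simp only [hS, Finset.mem_product, Finset.mem_univ, true_and, Set.Finite.mem_toFinset]
      exact ⟨hz', mem_closedBall.2 (by simpa using hzB)⟩
    exact hmin (m', z') hmem
  · rw [not_le] at hzB
    have h1 : dist p (t m + A z) ≤ D := hmin (0, 0) h00
    have h2 : D ≤ dist p (t m' + A z') := by
      have hAz : (189 / 200) * ‖z'‖ ≤ ‖A z'‖ := adm_le_norm hA z'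
      have htri : ‖A z'‖ ≤ dist p (t m' + A z') + ‖p‖ + ‖t m'‖ := by
        have e : A z' = (t m' + A z' - p) + p - t m' := by abel
        calc ‖A z'‖ = ‖(t m' + A z' - p) + p - t m'‖ := by rw [← e]
          _ ≤ ‖(t m' + A z' - p) + p‖ + ‖t m'‖ := norm_sub_le _ _
          _ ≤ ‖t m' + A z' - p‖ + ‖p‖ + ‖t m'‖ := by linarith [norm_add_le (t m' + A z' - p) p]
          _ = dist p (t m' + A z') + ‖p‖ + ‖t m'‖ := by rw [dist_comm, dist_eq_norm]
      have hBz : D + ‖p‖ + Tn < (189 / 200) * ‖z'‖ := by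
        have : (189 / 200 : ℝ) * B = D + ‖p‖ + Tn := by rw [hB]; ring
        nlinarith
      linarith [htm m']
    exact h1.trans h2

/-! ### Global coarse matching of local limits -/

/-- **Coarse matching passes to local limits.** Let `Y_k ⊆ ℝ³` be two-way `1/40`-matched on the
ball `‖·‖ ≤ k` with the sites of admissible data `(t_k, A_k)`, with `A_k → A`, `t_k → t` and `A`
admissible; let `Y` be `δ`-separated and a local limit of the `Y_k` (for every `R` and `ε > 0`,
eventually `BallMatch ε R 0 (Y_k) Y`).  Then `Y` is two-way `1/40`-matched with the sites of
`(t, A)` on every ball.  (Nearest sites / nearest points exist by local finiteness, and their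
distance is `≤ 1/40 + η` for every `η > 0`.) [folklore] -/
theorem near_of_limit {Y : ℕ → Set E3} {t : ℕ → Fin 2 → E3} {A : ℕ → E3 →L[ℝ] E3}
    {Yinf : Set E3} {tinf : Fin 2 → E3} {Ainf : E3 →L[ℝ] E3} {δ : ℝ} (hδ : 0 < δ)
    (hA : ∀ k, Adm (A k)) (hAinf : Adm Ainf)
    (hnear : ∀ k : ℕ, Near (Y k) 0 k (t k) (A k) (1 / 40))
    (hsep : ∀ p ∈ Yinf, ∀ q ∈ Yinf, p ≠ q → δ ≤ dist p q)
    (hlimA : Tendsto A atTop (𝓝 Ainf)) (hlimt : Tendsto t atTop (𝓝 tinf))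
    (hBM : ∀ R ε : ℝ, 0 < ε → ∀ᶠ k in atTop, BallMatch ε R 0 (Y k) Yinf) (c : E3) (r : ℝ) :
    Near Yinf c r tinf Ainf (1 / 40) := by
  classical
  -- a uniform bound on the translations
  obtain ⟨Tb, hTb⟩ := hlimt.norm.isBoundedUnder_le
  have hTb' : ∀ᶠ k in atTop, ∀ m, ‖t k m‖ ≤ Tb := by
    filter_upwards [hTb] with k hk m using (norm_le_pi_norm (t k) m).trans hk
  have hTb0 : 0 ≤ Tb := by
    obtain ⟨k, hk⟩ := hTb'.exists
    exact (norm_nonneg _).trans (hk 0)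
  -- componentwise convergence of the data
  have hlimtm : ∀ m, Tendsto (fun k => t k m) atTop (𝓝 (tinf m)) := fun m =>
    (continuous_apply m).continuousAt.tendsto.comp hlimt
  refine ⟨fun p hp _ => ?_, fun m z hz _ => ?_⟩
  · -- points of `Yinf` are within `1/40` of their nearest site
    obtain ⟨m, z, hz, hmin⟩ := exists_forall_dist_site_le hAinf tinf p
    refine ⟨m, z, hz, le_of_forall_pos_le_add fun η hη => ?_⟩
    set ε : ℝ := η / 3 with hε
    have hε0 : 0 < ε := by positivity
    set B : ℝ := 200 / 189 * (‖p‖ + ε + 1 / 40 + Tb) with hB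
    have hB0 : 0 < B := by positivity
    have h1 := hBM ‖p‖ ε hε0
    have h2 : ∀ᶠ k : ℕ in atTop, ‖p‖ + ε ≤ k := tendsto_natCast_atTop_atTop.eventually_ge_atTop _
    have h3 : ∀ᶠ k in atTop, ∀ m, dist (t k m) (tinf m) ≤ ε / 2 :=
      eventually_all.2 fun m => (Metric.tendsto_nhds.1 (hlimtm m) (ε / 2) (by positivity)).mono
        fun k hk => hk.le
    have h4 : ∀ᶠ k in atTop, dist (A k) Ainf ≤ ε / 2 / B :=
      (Metric.tendsto_nhds.1 hlimA (ε / 2 / B) (by positivity)).mono fun k hk => hk.le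
    obtain ⟨k, hk1, hk2, hk3, hk4, hk5⟩ := (h1.and (h2.and (h3.and (h4.and hTb')))).exists
    obtain ⟨q, hq, hqp⟩ := hk1.1 p hp (by rw [dist_zero_right])
    have hq0 : dist q 0 ≤ k := by
      rw [dist_zero_right]
      have : ‖q‖ ≤ ‖p‖ + dist q p := by rw [dist_eq_norm]; linarith [norm_sub_norm_le q p]
      linarith
    obtain ⟨m', z', hz', hqs⟩ := (hnear k).1 q hq hq0
    -- the lattice index is bounded
    have hz'B : ‖z'‖ ≤ B := by
      have hAz : (189 / 200) * ‖z'‖ ≤ ‖A k z'‖ := adm_le_norm (hA k) z'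
      have hs : ‖A k z'‖ ≤ ‖q‖ + 1 / 40 + ‖t k m'‖ := by
        have e : A k z' = (t k m' + A k z' - q) + q - t k m' := by abel
        calc ‖A k z'‖ = ‖(t k m' + A k z' - q) + q - t k m'‖ := by rw [← e]
          _ ≤ ‖(t k m' + A k z' - q) + q‖ + ‖t k m'‖ := norm_sub_le _ _
          _ ≤ ‖t k m' + A k z' - q‖ + ‖q‖ + ‖t k m'‖ := by
              linarith [norm_add_le (t k m' + A k z' - q) q]
          _ ≤ ‖q‖ + 1 / 40 + ‖t k m'‖ := by
              rw [← dist_eq_norm, dist_comm]; linarith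
      have hqn : ‖q‖ ≤ ‖p‖ + ε := by
        have : ‖q‖ ≤ ‖p‖ + dist q p := by rw [dist_eq_norm]; linarith [norm_sub_norm_le q p]
        linarith
      have : (189 / 200 : ℝ) * B = ‖p‖ + ε + 1 / 40 + Tb := by rw [hB]; ring
      nlinarith [hk5 m']
    -- the limit site with the same index is `ε`-close to the `k`-th site
    have hss : dist (t k m' + A k z') (tinf m' + Ainf z') ≤ ε := by
      have e : t k m' + A k z' - (tinf m' + Ainf z') = (t k m' - tinf m') + (A k - Ainf) z' := by
        rw [FunLike.coe_sub, Pi.sub_apply]; abel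
      rw [dist_eq_norm, e]
      have hAB : ‖(A k - Ainf) z'‖ ≤ ε / 2 := by
        calc ‖(A k - Ainf) z'‖ ≤ ‖A k - Ainf‖ * ‖z'‖ := ContinuousLinearMap.le_opNorm _ _
          _ ≤ (ε / 2 / B) * B := by
              rw [← dist_eq_norm]
              exact mul_le_mul hk4 hz'B (norm_nonneg _) (by positivity)
          _ = ε / 2 := by field_simp
      calc ‖(t k m' - tinf m') + (A k - Ainf) z'‖ ≤ ‖t k m' - tinf m'‖ + ‖(A k - Ainf) z'‖ := norm_add_le _ _
        _ ≤ ε / 2 + ε / 2 := by rw [← dist_eq_norm]; exact add_le_add (hk3 m') hAB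
        _ = ε := by ring
    calc dist p (tinf m + Ainf z) ≤ dist p (tinf m' + Ainf z') := hmin m' z' hz'
      _ ≤ dist p q + dist q (t k m' + A k z') + dist (t k m' + A k z') (tinf m' + Ainf z') :=
          dist_triangle4 _ _ _ _
      _ ≤ ε + 1 / 40 + ε := by rw [dist_comm p q]; linarith
      _ ≤ 1 / 40 + η := by rw [hε]; linarith
  · -- sites of the limit datum are within `1/40` of their nearest point of `Yinf`
    set σ : E3 := tinf m + Ainf z with hσ
    have key : ∀ η : ℝ, 0 < η → ∃ y ∈ Yinf, dist y σ ≤ 1 / 40 + η := by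
      intro η hη
      set ε : ℝ := min (η / 3) 1 with hε
      have hε0 : 0 < ε := lt_min (by positivity) one_pos
      have hε1 : ε ≤ 1 := min_le_right _ _
      have hεη : 3 * ε ≤ η := by have := min_le_left (η / 3) 1; linarith
      have hsk : Tendsto (fun k => t k m + A k z) atTop (𝓝 σ) :=
        (hlimtm m).add (((ContinuousLinearMap.apply ℝ E3 z).continuous.tendsto Ainf).comp hlimA)
      have h1 : ∀ᶠ k in atTop, dist (t k m + A k z) σ ≤ ε :=
        (Metric.tendsto_nhds.1 hsk ε hε0).mono fun k hk => hk.le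
      have h2 : ∀ᶠ k : ℕ in atTop, ‖σ‖ + ε ≤ k :=
        tendsto_natCast_atTop_atTop.eventually_ge_atTop _
      have h3 := hBM (‖σ‖ + 2) ε hε0
      obtain ⟨k, hk1, hk2, hk3⟩ := (h1.and (h2.and h3)).exists
      have hσk : dist (t k m + A k z) 0 ≤ k := by
        rw [dist_zero_right]
        have : ‖t k m + A k z‖ ≤ ‖σ‖ + dist (t k m + A k z) σ := by
          rw [dist_eq_norm]; linarith [norm_sub_norm_le (t k m + A k z) σ]
        linarith
      obtain ⟨q, hq, hqσ⟩ := (hnear k).2 m z hz hσk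
      have hq0 : dist q 0 ≤ ‖σ‖ + 2 := by
        rw [dist_zero_right]
        have : ‖q‖ ≤ ‖σ‖ + dist (t k m + A k z) σ + dist q (t k m + A k z) := by
          rw [dist_eq_norm, dist_eq_norm]
          linarith [norm_sub_norm_le (t k m + A k z) σ, norm_sub_norm_le q (t k m + A k z)]
        linarith
      obtain ⟨y, hy, hqy⟩ := hk3.2 q hq hq0
      refine ⟨y, hy, ?_⟩
      calc dist y σ ≤ dist y q + dist q (t k m + A k z) + dist (t k m + A k z) σ :=
            dist_triangle4 _ _ _ _
        _ ≤ ε + 1 / 40 + ε := by rw [dist_comm y q]; linarith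
        _ ≤ 1 / 40 + η := by linarith
    -- the nearest point of the locally finite `Yinf`
    have hfin : (Yinf ∩ closedBall σ 1).Finite :=
      finite_of_forall_le_dist_of_subset_closedBall hδ
        (fun a ha b hb hab => hsep a ha.1 b hb.1 hab) Set.inter_subset_right
    obtain ⟨y₀, hy₀, hy₀d⟩ := key (1 / 2) one_half_pos
    have hy₀S : y₀ ∈ hfin.toFinset := by
      rw [Set.Finite.mem_toFinset]
      exact ⟨hy₀, mem_closedBall.2 (by linarith)⟩
    obtain ⟨y₁, hy₁, hmin⟩ := hfin.toFinset.exists_min_image (fun y => dist y σ) ⟨y₀, hy₀S⟩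
    rw [Set.Finite.mem_toFinset] at hy₁
    refine ⟨y₁, hy₁.1, le_of_forall_pos_le_add fun η hη => ?_⟩
    obtain ⟨y, hy, hyd⟩ := key (min η (1 / 2)) (lt_min hη one_half_pos)
    have hyS : y ∈ hfin.toFinset := by
      rw [Set.Finite.mem_toFinset]
      refine ⟨hy, mem_closedBall.2 ?_⟩
      linarith [min_le_right η (1 / 2)]
    calc dist y₁ σ ≤ dist y σ := hmin y hyS
      _ ≤ 1 / 40 + min η (1 / 2) := hyd
      _ ≤ 1 / 40 + η := by linarith [min_le_left η (1 / 2)]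

end Summit.AtomisticToContinuum.Crystallization.Theorems.ExcessDecayLiouvilleGrainsGlue

end
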